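import Literature.Topology.FourManifolds.LevelFlowExtension
import Literature.Topology.FourManifolds.LevelEmbedding
import Literature.Topology.FourManifolds.Diffeotopy
import Literature.Topology.FourManifolds.FieldPushforward
import Mathlib.Analysis.SpecialFunctions.SmoothTransition
import HarnessLib

/-!
# Suspending a diffeotopy of a level along a unit-speed flow

Topic `Literature/Topology/FourManifolds` (fact seat
`provefact-Literature.Topology.FourManifolds.IsHandlebody.exists_diffeomorph_isBoundaryGluing_sphere`,
step F2b₁ of the Lickorish–Wallace DAG; level step H2 of the reduction of L1
`oneHandle_nonempty_diffeomorph`: the correction of the seed diffeomorphism on the feet of the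
handle, obtained from the two-disc theorem in a level, has to be realised by a level-preserving
diffeomorphism of the ambient manifold commuting with the flow near that level).  Everything
here is **proved**; no named facts.

Let `S` be a unit-speed slab (`Literature.Topology.FourManifolds.UnitSlab`: `X(f) = 1` on
`f⁻¹(lo, hi)`, global flow `θ`), `c` a level with `[c - 3τ, c + 4τ] ⊆ [lo, hi]` whose sublevel
set `{f ≤ c}` is interior, and `V = ∂{f ≤ c}` the level manifold (structures `sublevelAtlas`,
`BoundaryManifold.chartedSpace`).  A point `y` of the box `f⁻¹(c - 3τ, c + 4τ)` has the flow
coordinates `(t, v) = (f y - c, θ(c - f y, y))` (`baseLevel`), `y = θ(t, v)`.  For a smooth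
family `F : ℝ → V → V` (the stages of a `Diffeotopy` of `V`, `Diffeotopy.lean`) the
**suspension** `suspWith F` (`Literature.Topology.FourManifolds.UnitSlab.suspWith`) is
`θ(t, F (χ t) v)` on the box and the identity elsewhere, where the time cutoff `χ`
(`levelTimeCutoff τ`, a product of Mathlib's `Real.smoothTransition`s) is `1` on `[-τ, 2τ]` and `0`
off `(-2τ, 3τ)`.  It preserves `f` (`apply_suspWith`), is the identity where `χ = 0` as soon
as `F 0 = id` (`suspWith_eq_self_of_le/ge`), composes stagewise (`suspWith_suspWith`), is
smooth when `F` is jointly smooth (`contMDiff_suspWith`: on the box it factors through the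
smooth flow coordinates, the lift `levelLift` to `V` being smooth by `LevelEmbedding.lean`, and
near the ends of the box it is the identity), and **conjugates the flow to the stage `F 1`** on
`f⁻¹[c - τ, c + 2τ]`: `suspWith F (θ (s, y)) = θ (s, suspWith F y)` there, whence its
differential fixes the field (`mfderiv_suspWith_apply`, uniqueness of velocities).  For a
diffeotopy `D` of `V` this gives the level-preserving diffeomorphism `suspDiffeomorph D` of `M`
equal to the `θ`-conjugate of the final stage `D₁` near the level `c`
(`suspDiffeomorph_flow`: `κ (θ (t, v)) = θ (t, D₁ v)`, `t ∈ [-τ, 2τ]`) and to the identity below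
`c - 2τ` and above `c + 3τ`.  (Milnor 1965 uses such flow-box suspensions tacitly in the proof
of Thm. 3.13, "we may assume that the diffeomorphism carries the left-hand discs to the
left-hand discs"; Hirsch 1976, Ch. 8 §1, Thm. 1.3 is the isotopy-extension principle behind
it.)

## References

* J. Milnor, *Lectures on the h-cobordism theorem* (1965), proof of Thm. 3.13 (PDF pp. 18–19).
  [MilnorHCobordism1965]
* M. W. Hirsch, *Differential Topology*, GTM 33 (1976), Ch. 8 §1, Thm. 1.3. [HirschDT1976]
-/

open scoped Manifold ContDiff Topology
open Set Function Filter Metric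

noncomputable section

namespace Literature.Topology.FourManifolds

universe u

/-! ### The time cutoff -/

/-- **The time cutoff** `χ`: `1` on `[-τ, 2τ]`, `0` off `(-2τ, 3τ)`. [folklore] -/
def levelTimeCutoff (τ t : ℝ) : ℝ :=
  Real.smoothTransition ((t + 2 * τ) / τ) * Real.smoothTransition ((3 * τ - t) / τ)

namespace levelTimeCutoff

variable {τ : ℝ}

/-- The cutoff is smooth. [folklore] -/
theorem contDiff : ContDiff ℝ ∞ (levelTimeCutoff τ) :=
  (Real.smoothTransition.contDiff.comp ((contDiff_id.add contDiff_const).div_const τ)).mul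
    (Real.smoothTransition.contDiff.comp ((contDiff_const.sub contDiff_id).div_const τ))

variable (hτ : 0 < τ)
include hτ

/-- The cutoff is `1` on `[-τ, 2τ]`. [folklore] -/
theorem eq_one {t : ℝ} (ht : t ∈ Icc (-τ) (2 * τ)) : levelTimeCutoff τ t = 1 := by
  unfold levelTimeCutoff
  rw [Real.smoothTransition.one_of_one_le, Real.smoothTransition.one_of_one_le, one_mul]
  · rw [le_div_iff₀ hτ]; linarith [ht.2]
  · rw [le_div_iff₀ hτ]; linarith [ht.1]

/-- The cutoff vanishes below `-2τ`. [folklore] -/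
theorem eq_zero_of_le {t : ℝ} (ht : t ≤ -2 * τ) : levelTimeCutoff τ t = 0 := by
  unfold levelTimeCutoff
  rw [Real.smoothTransition.zero_of_nonpos, zero_mul]
  exact div_nonpos_of_nonpos_of_nonneg (by linarith) hτ.le

/-- The cutoff vanishes above `3τ`. [folklore] -/
theorem eq_zero_of_ge {t : ℝ} (ht : 3 * τ ≤ t) : levelTimeCutoff τ t = 0 := by
  unfold levelTimeCutoff
  rw [Real.smoothTransition.zero_of_nonpos (x := (3 * τ - t) / τ), mul_zero]
  exact div_nonpos_of_nonpos_of_nonneg (by linarith) hτ.le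

end levelTimeCutoff

/-! ### The flow coordinates of a box around a level -/

namespace UnitSlab

variable {n : ℕ} {M : Type u} [TopologicalSpace M] [ChartedSpace (EuclideanHalfSpace (n + 1)) M]
  (S : UnitSlab (n := n) M) {c τ : ℝ}
  {hint : ∀ p, S.f p ≤ c → (𝓡∂ (n + 1)).IsInteriorPoint p}
  {hreg : ∀ p, S.f p = c → ¬ IsMCriticalPt (𝓡∂ (n + 1)) S.f p}

/-- **The box** `f⁻¹(c - 3τ, c + 4τ)` around the level `c`, an open submanifold. [folklore] -/
def box (c τ : ℝ) : TopologicalSpace.Opens M :=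
  ⟨{y | S.f y ∈ Ioo (c - 3 * τ) (c + 4 * τ)}, isOpen_Ioo.preimage S.hf.continuous⟩

/-- Membership in the box. [folklore] -/
@[simp] theorem mem_box {y : M} : y ∈ S.box c τ ↔ S.f y ∈ Ioo (c - 3 * τ) (c + 4 * τ) := Iff.rfl

variable (hτ : 0 < τ) (hlo : S.lo ≤ c - 3 * τ) (hhi : c + 4 * τ ≤ S.hi)

include hlo hhi in
/-- Levels of the box lie in the slab. [folklore] -/
theorem mem_slab_of_mem_box {r : ℝ} (hr : r ∈ Ioo (c - 3 * τ) (c + 4 * τ)) : r ∈ Ioo S.lo S.hi :=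
  ⟨lt_of_le_of_lt hlo hr.1, lt_of_lt_of_le hr.2 hhi⟩

include hτ hlo hhi in
/-- The level `c` lies in the slab. [folklore] -/
theorem level_mem_slab : c ∈ Ioo S.lo S.hi := ⟨by linarith, by linarith⟩

include hτ hlo hhi in
/-- **The base point** `θ(c - f y, y)` of a point of the box lies on the level `c`. [folklore] -/
theorem apply_base {y : M} (hy : S.f y ∈ Ioo (c - 3 * τ) (c + 4 * τ)) : S.f (S.θ (c - S.f y, y)) = c := by
  rw [S.apply_flow (S.mem_slab_of_mem_box hlo hhi hy) (by
    rw [show S.f y + (c - S.f y) = c by ring]; exact S.level_mem_slab hτ hlo hhi)]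
  ring

include hlo hhi in
/-- The clock inside the box. [folklore] -/
theorem apply_flow_of_mem_box (y : S.box c τ) {s : ℝ} (hs : S.f y + s ∈ Ioo (c - 3 * τ) (c + 4 * τ)) :
    S.f (S.θ (s, (y : M))) = S.f y + s :=
  S.apply_flow (S.mem_slab_of_mem_box hlo hhi y.2) (S.mem_slab_of_mem_box hlo hhi hs)

include hlo hhi in
/-- Flowing inside the box. [folklore] -/
theorem flow_mem_box_of_mem (y : S.box c τ) {s : ℝ} (hs : S.f y + s ∈ Ioo (c - 3 * τ) (c + 4 * τ)) :
    S.θ (s, (y : M)) ∈ S.box c τ := by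
  show S.f (S.θ (s, (y : M))) ∈ Ioo (c - 3 * τ) (c + 4 * τ)
  rw [S.apply_flow_of_mem_box hlo hhi y hs]; exact hs

variable [IsManifold (𝓡∂ (n + 1)) ∞ M] [csW : ChartedSpace (EuclideanHalfSpace (n + 1)) ↥(S.f ⁻¹' Iic c)]

/-- **The base point as a point of the level manifold** `∂{f ≤ c}` (a map on the box).
[folklore] -/
def baseLevel (hcs : csW = (sublevelAtlas S.hf c hint hreg).chartedSpace) (y : S.box c τ) :
    ↥((𝓡∂ (n + 1)).boundary ↥(S.f ⁻¹' Iic c)) :=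
  levelLift hcs (fun y : S.box c τ => S.θ (c - S.f y, y)) (fun y => S.apply_base hτ hlo hhi y.2) y

variable (hcs : csW = (sublevelAtlas S.hf c hint hreg).chartedSpace)

/-- The base point, as a point of `M`. [folklore] -/
@[simp] theorem baseLevel_coe (y : S.box c τ) :
    (((S.baseLevel hτ hlo hhi hcs y : ↥((𝓡∂ (n + 1)).boundary ↥(S.f ⁻¹' Iic c))) : ↥(S.f ⁻¹' Iic c)) : M) =
      S.θ (c - S.f y, y) := rfl

include hcs in
/-- Points of the level manifold lie on the level. [folklore] -/
theorem apply_coe (v : ↥((𝓡∂ (n + 1)).boundary ↥(S.f ⁻¹' Iic c))) : S.f ((v : ↥(S.f ⁻¹' Iic c)) : M) = c :=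
  apply_coe_coe_eq hcs v

/-- **Flowing a level point and taking the base gives the point back**: the base of
`θ(t, v)` is `v` (`t ∈ (-3τ, 4τ)`). [folklore] -/
theorem baseLevel_flow (v : ↥((𝓡∂ (n + 1)).boundary ↥(S.f ⁻¹' Iic c))) {t : ℝ} (ht : t ∈ Ioo (-3 * τ) (4 * τ))
    (hmem : S.θ (t, ((v : ↥(S.f ⁻¹' Iic c)) : M)) ∈ S.box c τ) :
    S.baseLevel hτ hlo hhi hcs ⟨S.θ (t, ((v : ↥(S.f ⁻¹' Iic c)) : M)), hmem⟩ = v := by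
  apply Subtype.ext; apply Subtype.ext
  show S.θ (c - S.f (S.θ (t, ((v : ↥(S.f ⁻¹' Iic c)) : M))), S.θ (t, ((v : ↥(S.f ⁻¹' Iic c)) : M))) = _
  have hv := S.apply_coe hcs v
  rw [S.apply_flow (by rw [hv]; exact S.level_mem_slab hτ hlo hhi) (by
      rw [hv]; exact ⟨by linarith [ht.1], by linarith [ht.2]⟩), hv,
    show c - (c + t) = -t by ring, S.flow_neg_flow]

include hτ hlo hhi hcs in
/-- A level point flowed by `t ∈ (-3τ, 4τ)` lies in the box. [folklore] -/
theorem flow_mem_box (v : ↥((𝓡∂ (n + 1)).boundary ↥(S.f ⁻¹' Iic c))) {t : ℝ} (ht : t ∈ Ioo (-3 * τ) (4 * τ)) :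
    S.θ (t, ((v : ↥(S.f ⁻¹' Iic c)) : M)) ∈ S.box c τ := by
  have hv := S.apply_coe hcs v
  show S.f (S.θ (t, ((v : ↥(S.f ⁻¹' Iic c)) : M))) ∈ Ioo (c - 3 * τ) (c + 4 * τ)
  rw [S.apply_flow (by rw [hv]; exact S.level_mem_slab hτ hlo hhi) (by
      rw [hv]; exact ⟨by linarith [ht.1], by linarith [ht.2]⟩), hv]
  exact ⟨by linarith [ht.1], by linarith [ht.2]⟩

/-- **The flow coordinates invert**: `θ(f y - c, base y) = y`. [folklore] -/
theorem flow_baseLevel (y : S.box c τ) :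
    S.θ (S.f y - c, (((S.baseLevel hτ hlo hhi hcs y : ↥((𝓡∂ (n + 1)).boundary ↥(S.f ⁻¹' Iic c))) :
      ↥(S.f ⁻¹' Iic c)) : M)) = y := by
  rw [baseLevel_coe, S.isFlowOf.map_add, show S.f y - c + (c - S.f y) = 0 by ring, S.isFlowOf.map_zero]

/-- **The base is constant along flow lines inside the box.** [folklore] -/
theorem baseLevel_flow_of_mem (y : S.box c τ) {s : ℝ} (hs : S.f y + s ∈ Ioo (c - 3 * τ) (c + 4 * τ)) :
    S.baseLevel hτ hlo hhi hcs ⟨S.θ (s, (y : M)), S.flow_mem_box_of_mem hlo hhi y hs⟩ =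
      S.baseLevel hτ hlo hhi hcs y := by
  apply Subtype.ext; apply Subtype.ext
  show S.θ (c - S.f (S.θ (s, (y : M))), S.θ (s, (y : M))) = S.θ (c - S.f y, y)
  rw [S.apply_flow_of_mem_box hlo hhi y hs, S.isFlowOf.map_add, show c - (S.f y + s) + s = c - S.f y by ring]

/-! ### The suspension of a family of maps of the level -/

/-- **The level manifold** `∂{f ≤ c}`. [folklore] -/
abbrev Level (S : UnitSlab (n := n) M) (c : ℝ) [ChartedSpace (EuclideanHalfSpace (n + 1)) ↥(S.f ⁻¹' Iic c)] : Type u :=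
  ↥((𝓡∂ (n + 1)).boundary ↥(S.f ⁻¹' Iic c))

/-- The inclusion of the level manifold in `M`. [folklore] -/
abbrev levelIncl (v : S.Level c) : M := ((v : ↥(S.f ⁻¹' Iic c)) : M)

/-- **The suspension** of a family `F : ℝ → V → V` of maps of the level manifold along the
flow: `θ(t, F (χ t) v)` in the flow coordinates `(t, v)` of the box, the identity elsewhere.
[cite: MilnorHCobordism1965, proof of Thm. 3.13 (PDF pp. 18–19)] -/
def suspWith (F : ℝ → S.Level c → S.Level c) (y : M) : M := by
  classical
  exact if h : S.f y ∈ Ioo (c - 3 * τ) (c + 4 * τ) then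
    S.θ (S.f y - c, S.levelIncl (F (levelTimeCutoff τ (S.f y - c)) (S.baseLevel hτ hlo hhi hcs ⟨y, h⟩)))
  else y

variable (F : ℝ → S.Level c → S.Level c)

/-- The suspension on the box. [folklore] -/
theorem suspWith_of_mem {y : M} (h : S.f y ∈ Ioo (c - 3 * τ) (c + 4 * τ)) :
    S.suspWith hτ hlo hhi hcs F y =
      S.θ (S.f y - c, S.levelIncl (F (levelTimeCutoff τ (S.f y - c)) (S.baseLevel hτ hlo hhi hcs ⟨y, h⟩))) := by
  simp [suspWith, h]

/-- The suspension off the box. [folklore] -/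
theorem suspWith_of_not_mem {y : M} (h : S.f y ∉ Ioo (c - 3 * τ) (c + 4 * τ)) :
    S.suspWith hτ hlo hhi hcs F y = y := by
  simp [suspWith, h]

/-- **The suspension preserves the levels of `f`.** [folklore] -/
theorem apply_suspWith (y : M) : S.f (S.suspWith hτ hlo hhi hcs F y) = S.f y := by
  by_cases h : S.f y ∈ Ioo (c - 3 * τ) (c + 4 * τ)
  · rw [S.suspWith_of_mem hτ hlo hhi hcs F h]
    have hv := S.apply_coe hcs (F (levelTimeCutoff τ (S.f y - c)) (S.baseLevel hτ hlo hhi hcs ⟨y, h⟩))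
    rw [levelIncl, S.apply_flow (by rw [hv]; exact S.level_mem_slab hτ hlo hhi)
      (by rw [hv, show c + (S.f y - c) = S.f y by ring]; exact S.mem_slab_of_mem_box hlo hhi h), hv]
    ring
  · rw [S.suspWith_of_not_mem hτ hlo hhi hcs F h]

/-- **Where the cutoff vanishes the suspension of a family starting at the identity is the
identity**: below `c - 2τ` and above `c + 3τ`. [folklore] -/
theorem suspWith_eq_self (hF0 : ∀ v, F 0 v = v) {y : M} (hy : S.f y ≤ c - 2 * τ ∨ c + 3 * τ ≤ S.f y) :
    S.suspWith hτ hlo hhi hcs F y = y := by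
  by_cases h : S.f y ∈ Ioo (c - 3 * τ) (c + 4 * τ)
  · rw [S.suspWith_of_mem hτ hlo hhi hcs F h]
    have h0 : levelTimeCutoff τ (S.f y - c) = 0 := by
      rcases hy with hy | hy
      · exact levelTimeCutoff.eq_zero_of_le hτ (by linarith)
      · exact levelTimeCutoff.eq_zero_of_ge hτ (by linarith)
    rw [h0, hF0]
    exact S.flow_baseLevel hτ hlo hhi hcs ⟨y, h⟩
  · exact S.suspWith_of_not_mem hτ hlo hhi hcs F h

/-- **On `f⁻¹[c - τ, c + 2τ]` the suspension is the flow conjugate of the stage `F 1`.**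
[folklore] -/
theorem suspWith_of_mem_Icc {y : M} (hy : S.f y ∈ Icc (c - τ) (c + 2 * τ)) :
    S.suspWith hτ hlo hhi hcs F y =
      S.θ (S.f y - c, S.levelIncl (F 1 (S.baseLevel hτ hlo hhi hcs ⟨y, ⟨by linarith [hy.1], by linarith [hy.2]⟩⟩))) := by
  rw [S.suspWith_of_mem hτ hlo hhi hcs F ⟨by linarith [hy.1], by linarith [hy.2]⟩,
    levelTimeCutoff.eq_one hτ ⟨by linarith [hy.1], by linarith [hy.2]⟩]

/-- **The suspension conjugates the flow of level points to the stage `F 1`**: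
`susp (θ (t, v)) = θ (t, F 1 v)` for `t ∈ [-τ, 2τ]`. [cite: MilnorHCobordism1965, proof of Thm. 3.13 (PDF pp. 18–19)] -/
theorem suspWith_flow (v : S.Level c) {t : ℝ} (ht : t ∈ Icc (-τ) (2 * τ)) :
    S.suspWith hτ hlo hhi hcs F (S.θ (t, S.levelIncl v)) = S.θ (t, S.levelIncl (F 1 v)) := by
  have ht' : t ∈ Ioo (-3 * τ) (4 * τ) := ⟨by linarith [ht.1], by linarith [ht.2]⟩
  have hmem := S.flow_mem_box hτ hlo hhi hcs v ht'
  have hlev : S.f (S.θ (t, S.levelIncl v)) = c + t := by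
    have hv := S.apply_coe hcs v
    rw [levelIncl, S.apply_flow (by rw [hv]; exact S.level_mem_slab hτ hlo hhi)
      (by rw [hv]; exact S.mem_slab_of_mem_box hlo hhi ⟨by linarith [ht.1], by linarith [ht.2]⟩), hv]
  rw [S.suspWith_of_mem_Icc hτ hlo hhi hcs F (by rw [hlev]; exact ⟨by linarith [ht.1], by linarith [ht.2]⟩)]
  have hb : S.baseLevel hτ hlo hhi hcs ⟨S.θ (t, S.levelIncl v), hmem⟩ = v := S.baseLevel_flow hτ hlo hhi hcs v ht' hmem
  simp only [hlev, add_sub_cancel_left]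
  rw [hb]

/-- **Stagewise composition of suspensions.** [folklore] -/
theorem suspWith_suspWith (G : ℝ → S.Level c → S.Level c) (y : M) :
    S.suspWith hτ hlo hhi hcs G (S.suspWith hτ hlo hhi hcs F y) =
      S.suspWith hτ hlo hhi hcs (fun s v => G s (F s v)) y := by
  by_cases h : S.f y ∈ Ioo (c - 3 * τ) (c + 4 * τ)
  · have hz : S.f (S.suspWith hτ hlo hhi hcs F y) ∈ Ioo (c - 3 * τ) (c + 4 * τ) := by
      rw [S.apply_suspWith hτ hlo hhi hcs F y]; exact h
    rw [S.suspWith_of_mem hτ hlo hhi hcs G hz, S.suspWith_of_mem hτ hlo hhi hcs (fun s v => G s (F s v)) h]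
    have hT : S.f (S.suspWith hτ hlo hhi hcs F y) - c = S.f y - c := by rw [S.apply_suspWith hτ hlo hhi hcs F y]
    have ht' : S.f y - c ∈ Ioo (-3 * τ) (4 * τ) := ⟨by linarith [h.1], by linarith [h.2]⟩
    -- the base of `susp F y` is the moved base of `y`
    have hb : S.baseLevel hτ hlo hhi hcs ⟨S.suspWith hτ hlo hhi hcs F y, hz⟩ =
        F (levelTimeCutoff τ (S.f y - c)) (S.baseLevel hτ hlo hhi hcs ⟨y, h⟩) := by
      have hmem : S.θ (S.f y - c, S.levelIncl (F (levelTimeCutoff τ (S.f y - c)) (S.baseLevel hτ hlo hhi hcs ⟨y, h⟩))) ∈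
          S.box c τ := S.flow_mem_box hτ hlo hhi hcs _ ht'
      have := S.baseLevel_flow hτ hlo hhi hcs (F (levelTimeCutoff τ (S.f y - c)) (S.baseLevel hτ hlo hhi hcs ⟨y, h⟩)) ht' hmem
      rw [← this]
      congr 1
      exact Subtype.ext (S.suspWith_of_mem hτ hlo hhi hcs F h)
    rw [hT, hb]
  · rw [S.suspWith_of_not_mem hτ hlo hhi hcs F h, S.suspWith_of_not_mem hτ hlo hhi hcs G h,
      S.suspWith_of_not_mem hτ hlo hhi hcs _ h]

/-- The suspension of the identity family is the identity. [folklore] -/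
theorem suspWith_id (y : M) : S.suspWith hτ hlo hhi hcs (fun _ v => v) y = y := by
  by_cases h : S.f y ∈ Ioo (c - 3 * τ) (c + 4 * τ)
  · rw [S.suspWith_of_mem hτ hlo hhi hcs _ h]
    exact S.flow_baseLevel hτ hlo hhi hcs ⟨y, h⟩
  · exact S.suspWith_of_not_mem hτ hlo hhi hcs _ h

/-! ### Smoothness -/

variable [mfdW : IsManifold (𝓡∂ (n + 1)) ∞ ↥(S.f ⁻¹' Iic c)]

include hcs in
/-- The inclusion `{f ≤ c} → M` is smooth (dimension `n + 1 ≥ 2`). [folklore] -/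
theorem contMDiff_val (hn : 1 ≤ n) : ContMDiff (𝓡∂ (n + 1)) (𝓡∂ (n + 1)) ∞ (Subtype.val : ↥(S.f ⁻¹' Iic c) → M) := by
  subst hcs
  exact (sublevelAtlas S.hf c hint hreg).contMDiff_subtype_val hn

include hcs in
/-- The inclusion of the level manifold is smooth. [cite: LeeSmoothManifolds2013, Thm. 5.11] -/
theorem contMDiff_levelIncl (hn : 1 ≤ n) : ContMDiff (𝓡 n) (𝓡∂ (n + 1)) ∞ (S.levelIncl (c := c)) :=
  (S.contMDiff_val hcs hn).comp (BoundaryManifold.isImmersion_subtype_val (W := ↥(S.f ⁻¹' Iic c))).contMDiff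

/-- **The base map is smooth on the box** (flow, then the lift to the level manifold,
`LevelEmbedding.lean`). [cite: LeeSmoothManifolds2013, Cor. 5.30] -/
theorem contMDiff_baseLevel : ContMDiff (𝓡∂ (n + 1)) (𝓡 n) ∞ (S.baseLevel hτ hlo hhi hcs) := by
  intro y
  exact contMDiffAt_levelLift hcs (fun w : S.box c τ => S.apply_base hτ hlo hhi w.2)
    (S.flow.contMDiff.contMDiffAt.comp y
      ((contMDiffAt_const.sub ((S.hf.comp contMDiff_subtype_val) y)).prodMk (contMDiff_subtype_val y)))

/-- The suspension read on the box. [folklore] -/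
theorem suspWith_comp_coe (hn : 1 ≤ n) (hF : ContMDiff (𝓘(ℝ, ℝ).prod (𝓡 n)) (𝓡 n) ∞ (uncurry F)) :
    ContMDiff (𝓡∂ (n + 1)) (𝓡∂ (n + 1)) ∞ fun y : S.box c τ => S.suspWith hτ hlo hhi hcs F y := by
  have heq : (fun y : S.box c τ => S.suspWith hτ hlo hhi hcs F y) = fun y : S.box c τ =>
      S.θ (S.f y - c, S.levelIncl (uncurry F (levelTimeCutoff τ (S.f y - c), S.baseLevel hτ hlo hhi hcs y))) := by
    funext y; exact S.suspWith_of_mem hτ hlo hhi hcs F y.2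
  rw [heq]
  have hT : ContMDiff (𝓡∂ (n + 1)) 𝓘(ℝ, ℝ) ∞ fun y : S.box c τ => S.f y - c :=
    (S.hf.comp contMDiff_subtype_val).sub contMDiff_const
  have hχ : ContMDiff (𝓡∂ (n + 1)) 𝓘(ℝ, ℝ) ∞ fun y : S.box c τ => levelTimeCutoff τ (S.f y - c) :=
    (levelTimeCutoff.contDiff (τ := τ)).contMDiff.comp hT
  have hFc : ContMDiff (𝓡∂ (n + 1)) (𝓡 n) ∞ fun y : S.box c τ =>
      uncurry F (levelTimeCutoff τ (S.f y - c), S.baseLevel hτ hlo hhi hcs y) :=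
    hF.comp (hχ.prodMk (S.contMDiff_baseLevel hτ hlo hhi hcs))
  exact S.flow.contMDiff.comp (hT.prodMk ((S.contMDiff_levelIncl hcs hn).comp hFc))

/-- **The suspension of a jointly smooth family starting at the identity is smooth** (the box
formula on the box, the identity near its ends). [cite: HirschDT1976, Ch. 8 §1, Thm. 1.3] -/
theorem contMDiff_suspWith (hn : 1 ≤ n) (hF : ContMDiff (𝓘(ℝ, ℝ).prod (𝓡 n)) (𝓡 n) ∞ (uncurry F))
    (hF0 : ∀ v, F 0 v = v) :
    ContMDiff (𝓡∂ (n + 1)) (𝓡∂ (n + 1)) ∞ (S.suspWith hτ hlo hhi hcs F) := by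
  intro y
  by_cases h : S.f y ∈ Ioo (c - 3 * τ) (c + 4 * τ)
  · exact (contMDiffAt_subtype_iff (U := S.box c τ) (x := ⟨y, h⟩)).1 (S.suspWith_comp_coe hτ hlo hhi hcs F hn hF ⟨y, h⟩)
  · -- near `y` the suspension is the identity
    have hy : S.f y ≤ c - 3 * τ ∨ c + 4 * τ ≤ S.f y := by
      by_contra hc
      simp only [not_or, not_le] at hc
      exact h ⟨hc.1, hc.2⟩
    have hev : S.suspWith hτ hlo hhi hcs F =ᶠ[𝓝 y] id := by
      rcases hy with hy | hy
      · filter_upwards [(isOpen_lt S.hf.continuous continuous_const).mem_nhds (show S.f y < c - 2 * τ by linarith)]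
          with z hz
        exact S.suspWith_eq_self hτ hlo hhi hcs F hF0 (Or.inl hz.le)
      · filter_upwards [(isOpen_lt continuous_const S.hf.continuous).mem_nhds (show c + 3 * τ < S.f y by linarith)]
          with z hz
        exact S.suspWith_eq_self hτ hlo hhi hcs F hF0 (Or.inr hz.le)
    exact contMDiffAt_id.congr_of_eventuallyEq hev

/-! ### The suspension of a diffeotopy of the level -/

variable (hn : 1 ≤ n) (D : Diffeotopy (𝓡 n) (S.Level c))

/-- **The suspension of a diffeotopy of the level manifold**: a level-preserving diffeomorphism
of `M`, the flow conjugate of the final stage near the level and the identity away from it.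
[cite: MilnorHCobordism1965, proof of Thm. 3.13 (PDF pp. 18–19)] -/
def suspDiffeomorph : M ≃ₘ⟮𝓡∂ (n + 1), 𝓡∂ (n + 1)⟯ M where
  toFun := S.suspWith hτ hlo hhi hcs D.toFun
  invFun := S.suspWith hτ hlo hhi hcs D.invFun
  left_inv y := by
    rw [S.suspWith_suspWith hτ hlo hhi hcs]
    simp only [Diffeotopy.invFun_toFun]
    exact S.suspWith_id hτ hlo hhi hcs y
  right_inv y := by
    rw [S.suspWith_suspWith hτ hlo hhi hcs]
    simp only [Diffeotopy.toFun_invFun]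
    exact S.suspWith_id hτ hlo hhi hcs y
  contMDiff_toFun := S.contMDiff_suspWith hτ hlo hhi hcs D.toFun hn D.contMDiff_uncurry_toFun
    fun v => by rw [D.toFun_zero]; rfl
  contMDiff_invFun := S.contMDiff_suspWith hτ hlo hhi hcs D.invFun hn D.contMDiff_uncurry_invFun
    fun v => by rw [D.invFun_zero]; rfl

/-- The suspension as a function. [folklore] -/
@[simp] theorem coe_suspDiffeomorph : ⇑(S.suspDiffeomorph hτ hlo hhi hcs hn D) = S.suspWith hτ hlo hhi hcs D.toFun := rfl

/-- **The suspension preserves the levels.** [folklore] -/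
theorem apply_suspDiffeomorph (y : M) : S.f (S.suspDiffeomorph hτ hlo hhi hcs hn D y) = S.f y :=
  S.apply_suspWith hτ hlo hhi hcs D.toFun y

/-- **The suspension is the identity below `c - 2τ` and above `c + 3τ`.** [folklore] -/
theorem suspDiffeomorph_eq_self {y : M} (hy : S.f y ≤ c - 2 * τ ∨ c + 3 * τ ≤ S.f y) :
    S.suspDiffeomorph hτ hlo hhi hcs hn D y = y :=
  S.suspWith_eq_self hτ hlo hhi hcs D.toFun (fun v => by rw [D.toFun_zero]; rfl) hy

/-- **Near the level the suspension is the flow conjugate of the final stage**: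
`κ (θ (t, v)) = θ (t, D₁ v)` for `t ∈ [-τ, 2τ]`. [cite: MilnorHCobordism1965, proof of Thm. 3.13 (PDF pp. 18–19)] -/
theorem suspDiffeomorph_flow (v : S.Level c) {t : ℝ} (ht : t ∈ Icc (-τ) (2 * τ)) :
    S.suspDiffeomorph hτ hlo hhi hcs hn D (S.θ (t, S.levelIncl v)) = S.θ (t, S.levelIncl (D.toFun 1 v)) :=
  S.suspWith_flow hτ hlo hhi hcs D.toFun v ht

/-- **The suspension commutes with the flow on `f⁻¹[c - τ, c + 2τ]`**: `κ (θ (s, y)) = θ (s, κ y)`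
whenever `f y` and `f y + s` lie in `[c - τ, c + 2τ]`. [folklore] -/
theorem suspDiffeomorph_flow_of_mem {y : M} (hy : S.f y ∈ Icc (c - τ) (c + 2 * τ)) {s : ℝ}
    (hs : S.f y + s ∈ Icc (c - τ) (c + 2 * τ)) :
    S.suspDiffeomorph hτ hlo hhi hcs hn D (S.θ (s, y)) = S.θ (s, S.suspDiffeomorph hτ hlo hhi hcs hn D y) := by
  have hbox : S.f y ∈ Ioo (c - 3 * τ) (c + 4 * τ) := ⟨by linarith [hy.1], by linarith [hy.2]⟩
  have hbox' : S.f y + s ∈ Ioo (c - 3 * τ) (c + 4 * τ) := ⟨by linarith [hs.1], by linarith [hs.2]⟩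
  have hlev : S.f (S.θ (s, y)) = S.f y + s := S.apply_flow_of_mem_box hlo hhi ⟨y, hbox⟩ hbox'
  rw [coe_suspDiffeomorph, S.suspWith_of_mem_Icc hτ hlo hhi hcs D.toFun (y := S.θ (s, y)) (by rw [hlev]; exact hs),
    S.suspWith_of_mem_Icc hτ hlo hhi hcs D.toFun (y := y) hy]
  have hb := S.baseLevel_flow_of_mem hτ hlo hhi hcs ⟨y, hbox⟩ hbox'
  simp only [hlev]
  rw [hb, S.isFlowOf.map_add, show S.f y + s - c = s + (S.f y - c) by ring]

/-- **The suspension commutes with the flow near the level**: for `f y ∈ (c - τ, c + 2τ)` and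
small `s`, `κ (θ (s, y)) = θ (s, κ y)`. [folklore] -/
theorem suspDiffeomorph_flow_eventuallyEq {y : M} (hy : S.f y ∈ Ioo (c - τ) (c + 2 * τ)) :
    (fun s => S.suspDiffeomorph hτ hlo hhi hcs hn D (S.θ (s, y))) =ᶠ[𝓝 0]
      fun s => S.θ (s, S.suspDiffeomorph hτ hlo hhi hcs hn D y) := by
  have hbox : S.f y ∈ Ioo (c - 3 * τ) (c + 4 * τ) := ⟨by linarith [hy.1], by linarith [hy.2]⟩
  -- times `s` with `f y + s ∈ (c - τ, c + 2τ)`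
  have hs : ∀ᶠ s in 𝓝 (0 : ℝ), S.f y + s ∈ Ioo (c - τ) (c + 2 * τ) := by
    have : Tendsto (fun s : ℝ => S.f y + s) (𝓝 0) (𝓝 (S.f y)) := by
      have h := (tendsto_const_nhds (x := S.f y) (f := 𝓝 (0 : ℝ))).add tendsto_id
      rwa [add_zero] at h
    exact this (isOpen_Ioo.mem_nhds hy)
  filter_upwards [hs] with s hs
  exact S.suspDiffeomorph_flow_of_mem hτ hlo hhi hcs hn D ⟨hy.1.le, hy.2.le⟩ ⟨hs.1.le, hs.2.le⟩

/-- **The differential of the suspension fixes the field near the level** (uniqueness of the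
velocity of `s ↦ κ (θ (s, y)) = θ (s, κ y)`). [cite: LeeSmoothManifolds2013, Prop. 9.6] -/
theorem mfderiv_suspDiffeomorph_apply {y : M} (hy : S.f y ∈ Ioo (c - τ) (c + 2 * τ)) :
    mfderiv (𝓡∂ (n + 1)) (𝓡∂ (n + 1)) (S.suspDiffeomorph hτ hlo hhi hcs hn D) (S.θ (0, y)) (S.X (S.θ (0, y))) =
      S.X (S.θ (0, S.suspDiffeomorph hτ hlo hhi hcs hn D y)) :=
  mfderiv_apply_eq_of_comp_eventuallyEq (S.flow.isMIntegralCurve y 0)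
    (S.flow.isMIntegralCurve (S.suspDiffeomorph hτ hlo hhi hcs hn D y) 0)
    ((S.suspDiffeomorph hτ hlo hhi hcs hn D).contMDiff.mdifferentiableAt (by simp))
    (S.suspDiffeomorph_flow_eventuallyEq hτ hlo hhi hcs hn D hy)

/-- The same, at the point `y` itself. [cite: LeeSmoothManifolds2013, Prop. 9.6] -/
theorem mfderiv_suspDiffeomorph_apply' {y : M} (hy : S.f y ∈ Ioo (c - τ) (c + 2 * τ)) :
    mfderiv (𝓡∂ (n + 1)) (𝓡∂ (n + 1)) (S.suspDiffeomorph hτ hlo hhi hcs hn D) y (S.X y) =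
      S.X (S.suspDiffeomorph hτ hlo hhi hcs hn D y) := by
  have h := S.mfderiv_suspDiffeomorph_apply hτ hlo hhi hcs hn D hy
  rwa [S.isFlowOf.map_zero, S.isFlowOf.map_zero] at h

end UnitSlab

end Literature.Topology.FourManifolds
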